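import Literature.AlgebraicGeometry.Hyperkaehler.K3HilbertTypeDominatedByWeilFourfoldPowers
import Literature.AlgebraicGeometry.Hyperkaehler.K3HilbertTypeTranscendentalSignature
import Literature.AlgebraicGeometry.Surfaces.DiagonalFormsEmbedU3m
import Literature.AlgebraicGeometry.Surfaces.K3TranscendentalWittIndexTwoKugaSatakeHodge
import HarnessLib

/-!
# Projective varieties of `K3^[n]`-type with Picard number `ρ ≥ 18`: the Hodge conjecture for the variety and all
# its powers — from Floccari–Fu 2026 Thm. 13.2 (i) / Cor. 13.4 (PREPRINT), Arapura 2006 Lemma 4.2 and the signature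
# of the transcendental lattice, BY NAME — PROVED modulo the cited facts

Family `hodge`, layer `Literature/AlgebraicGeometry/Hyperkaehler`. Written for the cell `hodge-nonav` (planner memo
ROUTE-P3v20-g29-ADD1 §H1 = THEOREM A♯; planner sketch `p3/hosts-g29/RankEighteenHKSketch.lean` r2, re-proved here
over the tree names with its two non-print inputs now in the tree: W1 = `Surfaces.diagEmbedsU3m` (PROVED) and
W2-HK = the signature fact `Huybrechts1999_k3HilbertType_transcendentalPart_signature`). THEOREMS ONLY (no
definition, no named fact, no instance; D-0026 net debt `0`). The K3-SURFACE twin is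
`Surfaces/K3PicardRankSeventeenKugaSatakeHodge`.

THE RESULT. Floccari–Fu (arXiv:2607.07528, Thm. 13.2 (i) with Cor. 13.4; tree fact
`FloccariFu2026_k3HilbertType_transcendentalEmbedding_isDominatedByPowers_discOneWeilFourfold` with its kernel
corollary `….hodgeConjectureFor_powers`, which also consumes the refereed `FloccariFu2026_hodgeClasses_algebraic_powers_discOneWeilFourfold`
and `Arapura2006_hodgeClasses_algebraic_of_isDominatedByPowers`): if the rational transcendental lattice of a
projective `K3^[n]`-type variety `X` (`n ≥ 2`) embeds isometrically into `(U^{⊕3} ⊕ ⟨−a⟩)_ℚ`, then the Hodge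
conjecture holds for `X` and all its powers. For `ρ(X) ≥ 18`, i.e. `rank T(X) = 23 − ρ(X) ≤ 5`, the hypothesis
ALWAYS holds: `T(X)_ℚ` is non-degenerate of signature `(2, r − 2)` for the Beauville–Bogomolov form (Huybrechts
1999 §1.9; tree fact `Huybrechts1999_k3HilbertType_transcendentalPart_signature`) and every such space of rank
`r ≤ 5` embeds into `(U^{⊕3} ⊕ ⟨−m⟩)_ℚ` for a suitable `m` (tree theorem `Surfaces.diagEmbedsU3m`). Hence: **for
every smooth projective variety of `K3^[n]`-type with `ρ(X) ≥ 18`, the Hodge conjecture holds for `X` and for all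
powers `X^{m+1}`** (modulo the cited facts, the first of which is a PREPRINT record).

WHAT IS PROVED (all modulo the facts passed BY NAME as hypotheses `h`, `hFF`, `h42`, `hSig`).
* `bilinForm_eq_sum_mul_of_orthogonal_basis` — a bilinear form in an orthogonal basis is the diagonal form of
  its weights: `B t t' = Σ wᵢ · eᵢ*(t) · eᵢ*(t')`.
* `hodgeConjectureFor_powers_k3HilbertType_of_transcendental_orthogonal_basis` — THEOREM A♯ with the orthogonal
  basis (`r ≤ 5` members, K3-type weights for `−P`) as explicit data; W1 from the tree.
* **`hodgeConjectureFor_powers_k3HilbertType_of_finrank_transcendental_le_five`** — THEOREM A♯: hypotheses = the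
  three records + the signature fact BY NAME, a projective `K3^[n]`-type `X` (`n ≥ 2`), a Fujiki form, a
  presentation `(T, H, P, j)` of the transcendental part, and `dim_ℚ T ≤ 5` (`ρ(X) ≥ 18`); conclusion = the Hodge
  conjecture for `X` and for every power `X^{m+1}`.
* (appended, same seat) `hodgeConjectureFor_powers_k3HilbertType_of_gramEmbedding` — any rank: an orthogonal basis with
  weights `w` and ANY injective isometric embedding of `⟨w⟩` into `(U³ ⊕ ⟨−a⟩)_ℚ` give the conclusion;
  **`hodgeConjectureFor_powers_k3HilbertType_of_transcendental_hyperbolic_two`** — the `ρ(X) = 17`, Witt-index-two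
  clause (H1♭): `−P`-Gram `diag(1, −1, 1, −1, c₀, c₁)`, `c₀ ≠ 0`, `c₁ < 0` (`T(X)_ℚ ≅ U_ℚ² ⊥ ⟨c₀, c₁⟩`), via the tree's
  `Surfaces.exists_u3m_embedding_hyperbolic_two`; modulo the three records only (no signature fact needed).

## References
* [FloccariFu2026HyperKummer] S. Floccari, L. Fu, *The hyper-Kummer construction*, arXiv:2607.07528 — Thm. 13.2 (i),
  Cor. 13.4 (PREPRINT).
* [FloccariFu2026] S. Floccari, L. Fu, J. Math. Pures Appl. (2026) — Thm. 1.2.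
* [Arapura2006] D. Arapura, Lemma 4.2.
* [Huybrechts1999] D. Huybrechts, Invent. Math. 135 (1999) — §1.9 (via the signature fact).
* [Serre1973] J.-P. Serre, *A Course in Arithmetic* — Ch. IV §3.3 (via `diagEmbedsU3m`).

## Provenance
Cell `hodge-nonav` (summit `HodgeConjecture`, rung F-H1), memo ROUTE-P3v20-g29-ADD1 §H1 and sketch
`RankEighteenHKSketch.lean` r2 (sha16 3900019da5756caa, P3 g29); seat `littype-FH1-2` (literature-prover,
generation 17).
-/

noncomputable section

open Literature.AlgebraicTopology.SingularHomology

namespace Literature.AlgebraicGeometry.Hyperkaehler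

open HodgeTheory
open Motives (SchemeOver IsSmoothProjective HodgeStructure)
open Surfaces (U3mIndex u3mFormQ)

/-! ### §1 A bilinear form in an orthogonal basis -/

/-- **A bilinear form in an orthogonal basis is the diagonal form of its weights**:
`B t t' = Σ wᵢ · eᵢ*(t) · eᵢ*(t')` when `B (e i) (e k) = δᵢₖ wᵢ`. [cite: Serre1973, Ch. IV §1.2]
[cite: Huybrechts1999, §1.9] -/
theorem bilinForm_eq_sum_mul_of_orthogonal_basis {T : Type} [AddCommGroup T] [Module ℚ T]
    (B : LinearMap.BilinForm ℚ T) {r : ℕ} (e : Module.Basis (Fin r) ℚ T) (w : Fin r → ℚ)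
    (hgram : ∀ i k, B (e i) (e k) = if i = k then w i else 0) (t t' : T) :
    B t t' = ∑ i, w i * e.equivFun t i * e.equivFun t' i := by
  conv_lhs => rw [← e.sum_equivFun t, ← e.sum_equivFun t']
  simp only [map_sum, map_smul, LinearMap.sum_apply, LinearMap.smul_apply, smul_eq_mul, hgram, mul_ite,
    mul_zero, Finset.sum_ite_eq', Finset.mem_univ, if_true]
  exact Finset.sum_congr rfl fun i _ => by ring

/-! ### §2 THEOREM A♯ with the orthogonal basis as data -/

/-- **THEOREM A♯, basis form.** For `X` smooth projective of `K3^[n]`-type (`n ≥ 2`), a Fujiki form `b`, a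
presentation `(T, H, P, j)` of the transcendental part, and an orthogonal basis `e : Fin r → T` (`r ≤ 5`) with
`−P(eᵢ, eₖ) = δᵢₖ wᵢ`, `w` of K3 type (`w i > 0` for `i < 2`, `w i < 0` for `i ≥ 2`): the Hodge conjecture holds
for `X` and for every power `X^{m+1}` — Floccari–Fu Thm. 13.2 (i) / Cor. 13.4 and Arapura L. 4.2 BY NAME, the
embedding of `⟨w⟩` into `(U³ ⊕ ⟨−m⟩)_ℚ` by the tree theorem `Surfaces.diagEmbedsU3m`.
[cite: FloccariFu2026HyperKummer, Thm. 13.2 (i) and Cor. 13.4; PREPRINT] [cite: Arapura2006, Lemma 4.2]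
[cite: Serre1973, Ch. IV §3.3 Thm. 9] -/
theorem hodgeConjectureFor_powers_k3HilbertType_of_transcendental_orthogonal_basis
    (h : FloccariFu2026_k3HilbertType_transcendentalEmbedding_isDominatedByPowers_discOneWeilFourfold)
    (hFF : FloccariFu2026_hodgeClasses_algebraic_powers_discOneWeilFourfold)
    (h42 : Arapura2006_hodgeClasses_algebraic_of_isDominatedByPowers)
    {n : ℕ} (hn : 2 ≤ n) {X : SchemeOver ℂ} (hX : IsSmoothProjective (2 * n) X) (hK : IsOfK3HilbertType n X)
    {b : complexBetti X 2 →ₗ[ℂ] complexBetti X 2 →ₗ[ℂ] ℂ} (hb : IsFujikiForm n X b)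
    {M : HodgeModel (2 * n) X} {hM : M.IsHodgeSymmetric}
    {T : Type} [AddCommGroup T] [Module ℚ T] {H : HodgeStructure T 2} {P : H.Polarization}
    {j : H.Hom (bettiTwoHodgeStructureOfModel hX M hM)} (hT : IsTranscendentalPartHK hX M hM b H P j)
    {r : ℕ} (hr : r ≤ 5) (e : Module.Basis (Fin r) ℚ T) (w : Fin r → ℚ)
    (hw : ∀ i : Fin r, (i.val < 2 → 0 < w i) ∧ (2 ≤ i.val → w i < 0))
    (hgram : ∀ i k, -(P.form (e i) (e k)) = if i = k then w i else 0) :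
    HodgeConjectureFor (2 * n) X ∧ ∀ m : ℕ, HodgeConjectureFor ((m + 1) * (2 * n)) (X.pow (m + 1)) := by
  obtain ⟨a, ha, ι₀, hι₀, hiso₀⟩ := Surfaces.diagEmbedsU3m r hr w hw
  have hgram' : ∀ i k, (-P.form) (e i) (e k) = if i = k then w i else 0 := fun i k => by
    simpa only [LinearMap.neg_apply] using hgram i k
  refine FloccariFu2026_k3HilbertType_transcendentalEmbedding_isDominatedByPowers_discOneWeilFourfold.hodgeConjectureFor_powers
    h hFF h42 hn hX hK hb hT ha (ι := ι₀ ∘ₗ e.equivFun.toLinearMap) (hι₀.comp e.equivFun.injective) ?_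
  intro t t'
  rw [LinearMap.comp_apply, LinearMap.comp_apply, LinearEquiv.coe_toLinearMap, hiso₀,
    ← bilinForm_eq_sum_mul_of_orthogonal_basis (-P.form) e w hgram' t t', LinearMap.neg_apply,
    LinearMap.neg_apply]

/-! ### §3 THEOREM A♯ -/

/-- **THEOREM (projective `K3^[n]`-type varieties with `ρ ≥ 18`: the Hodge conjecture for the variety and all its
powers).** For every smooth projective variety `X` of `K3^[n]`-type (`n ≥ 2`), every Fujiki form `b`, every
presentation `(T, H, P, j)` of the transcendental part of `H²(X, ℚ)`, if `dim_ℚ T ≤ 5` — i.e. `ρ(X) ≥ 18`, as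
`dim T(X) = 23 − ρ(X)` — then the Hodge conjecture holds for `X` and for every power `X^{m+1}`; from
Floccari–Fu 2026 Thm. 13.2 (i) / Cor. 13.4 (`h`, PREPRINT), their refereed Weil-fourfold theorem (`hFF`),
Arapura 2006 L. 4.2 (`h42`) and the signature `(2, r − 2)` of the transcendental lattice (`hSig`), all BY NAME,
and the tree theorem `Surfaces.diagEmbedsU3m`. [cite: FloccariFu2026HyperKummer, Thm. 13.2 (i) and Cor. 13.4; PREPRINT]
[cite: Arapura2006, Lemma 4.2] [cite: Huybrechts1999, §1.9] -/
theorem hodgeConjectureFor_powers_k3HilbertType_of_finrank_transcendental_le_five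
    (h : FloccariFu2026_k3HilbertType_transcendentalEmbedding_isDominatedByPowers_discOneWeilFourfold)
    (hFF : FloccariFu2026_hodgeClasses_algebraic_powers_discOneWeilFourfold)
    (h42 : Arapura2006_hodgeClasses_algebraic_of_isDominatedByPowers)
    (hSig : Huybrechts1999_k3HilbertType_transcendentalPart_signature)
    {n : ℕ} (hn : 2 ≤ n) {X : SchemeOver ℂ} (hX : IsSmoothProjective (2 * n) X) (hK : IsOfK3HilbertType n X)
    {b : complexBetti X 2 →ₗ[ℂ] complexBetti X 2 →ₗ[ℂ] ℂ} (hb : IsFujikiForm n X b)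
    {M : HodgeModel (2 * n) X} {hM : M.IsHodgeSymmetric}
    {T : Type} [AddCommGroup T] [Module ℚ T] {H : HodgeStructure T 2} {P : H.Polarization}
    {j : H.Hom (bettiTwoHodgeStructureOfModel hX M hM)} (hT : IsTranscendentalPartHK hX M hM b H P j)
    (hrank : Module.finrank ℚ T ≤ 5) :
    HodgeConjectureFor (2 * n) X ∧ ∀ m : ℕ, HodgeConjectureFor ((m + 1) * (2 * n)) (X.pow (m + 1)) := by
  obtain ⟨r, hr, e, w, hw, hgram⟩ := hSig.exists_basis_rank_le hn hX hK hb hT hrank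
  exact hodgeConjectureFor_powers_k3HilbertType_of_transcendental_orthogonal_basis h hFF h42 hn hX hK hb hT hr e
    w hw hgram

/-! ### §4 (appended) Any explicit embedding of the Gram form; the `ρ = 17` Witt-index-two clause (H1♭) -/

/-- **General Gram-embedding form.** For `X` smooth projective of `K3^[n]`-type (`n ≥ 2`), a Fujiki form, a
presentation `(T, H, P, j)` of the transcendental part with an orthogonal basis `e : Fin r → T` of `−P`-weights `w`,
and ANY injective `ℚ`-linear `ι₀ : ℚʳ → (U³ ⊕ ⟨−a⟩)_ℚ` (`a > 0`) with `(ι₀ x . ι₀ y) = Σ wᵢ xᵢ yᵢ`: the Hodge conjecture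
holds for `X` and all its powers — Floccari–Fu Thm. 13.2 (i) / Cor. 13.4 and Arapura L. 4.2 BY NAME.
[cite: FloccariFu2026HyperKummer, Thm. 13.2 (i) and Cor. 13.4; PREPRINT] [cite: Arapura2006, Lemma 4.2] -/
theorem hodgeConjectureFor_powers_k3HilbertType_of_gramEmbedding
    (h : FloccariFu2026_k3HilbertType_transcendentalEmbedding_isDominatedByPowers_discOneWeilFourfold)
    (hFF : FloccariFu2026_hodgeClasses_algebraic_powers_discOneWeilFourfold)
    (h42 : Arapura2006_hodgeClasses_algebraic_of_isDominatedByPowers)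
    {n : ℕ} (hn : 2 ≤ n) {X : SchemeOver ℂ} (hX : IsSmoothProjective (2 * n) X) (hK : IsOfK3HilbertType n X)
    {b : complexBetti X 2 →ₗ[ℂ] complexBetti X 2 →ₗ[ℂ] ℂ} (hb : IsFujikiForm n X b)
    {M : HodgeModel (2 * n) X} {hM : M.IsHodgeSymmetric}
    {T : Type} [AddCommGroup T] [Module ℚ T] {H : HodgeStructure T 2} {P : H.Polarization}
    {j : H.Hom (bettiTwoHodgeStructureOfModel hX M hM)} (hT : IsTranscendentalPartHK hX M hM b H P j)
    {r : ℕ} (e : Module.Basis (Fin r) ℚ T) (w : Fin r → ℚ)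
    (hgram : ∀ i k, -(P.form (e i) (e k)) = if i = k then w i else 0)
    {a : ℕ} (ha : 0 < a) (ι₀ : (Fin r → ℚ) →ₗ[ℚ] (U3mIndex → ℚ)) (hι₀ : Function.Injective ι₀)
    (hiso₀ : ∀ x y, u3mFormQ a (ι₀ x) (ι₀ y) = ∑ i, w i * x i * y i) :
    HodgeConjectureFor (2 * n) X ∧ ∀ m : ℕ, HodgeConjectureFor ((m + 1) * (2 * n)) (X.pow (m + 1)) := by
  have hgram' : ∀ i k, (-P.form) (e i) (e k) = if i = k then w i else 0 := fun i k => by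
    simpa only [LinearMap.neg_apply] using hgram i k
  refine FloccariFu2026_k3HilbertType_transcendentalEmbedding_isDominatedByPowers_discOneWeilFourfold.hodgeConjectureFor_powers
    h hFF h42 hn hX hK hb hT ha (ι := ι₀ ∘ₗ e.equivFun.toLinearMap) (hι₀.comp e.equivFun.injective) ?_
  intro t t'
  rw [LinearMap.comp_apply, LinearMap.comp_apply, LinearEquiv.coe_toLinearMap, hiso₀,
    ← bilinForm_eq_sum_mul_of_orthogonal_basis (-P.form) e w hgram' t t', LinearMap.neg_apply,
    LinearMap.neg_apply]

/-- **(H1♭) Projective `K3^[n]`-type varieties with `T(X)_ℚ ≅ U_ℚ² ⊥ ⟨c₀, c₁⟩` (Witt index two; `ρ(X) = 17`): the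
Hodge conjecture for `X` and all its powers.** For `X` smooth projective of `K3^[n]`-type (`n ≥ 2`), a Fujiki form,
a presentation `(T, H, P, j)` of the transcendental part and a basis `e : Fin 6 → T` with
`−P(eᵢ, eₖ) = δᵢₖ · (1, −1, 1, −1, c₀, c₁)ᵢ`, `c₀ ≠ 0`, `c₁ < 0`: the Hodge conjecture holds for `X` and for every
power `X^{m+1}` — modulo Floccari–Fu Thm. 13.2 (i) / Cor. 13.4 (PREPRINT record), FF-JMPA and Arapura L. 4.2 BY NAME
only, the embedding `U_ℚ² ⊥ ⟨c₀, c₁⟩ ↪ (U³ ⊕ ⟨−m⟩)_ℚ` being the tree theorem `Surfaces.exists_u3m_embedding_hyperbolic_two`.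
[cite: FloccariFu2026HyperKummer, Thm. 13.2 (i) and Cor. 13.4; PREPRINT] [cite: Arapura2006, Lemma 4.2]
[cite: Serre1973, Ch. IV §1.3–§1.6] -/
theorem hodgeConjectureFor_powers_k3HilbertType_of_transcendental_hyperbolic_two
    (h : FloccariFu2026_k3HilbertType_transcendentalEmbedding_isDominatedByPowers_discOneWeilFourfold)
    (hFF : FloccariFu2026_hodgeClasses_algebraic_powers_discOneWeilFourfold)
    (h42 : Arapura2006_hodgeClasses_algebraic_of_isDominatedByPowers)
    {n : ℕ} (hn : 2 ≤ n) {X : SchemeOver ℂ} (hX : IsSmoothProjective (2 * n) X) (hK : IsOfK3HilbertType n X)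
    {b : complexBetti X 2 →ₗ[ℂ] complexBetti X 2 →ₗ[ℂ] ℂ} (hb : IsFujikiForm n X b)
    {M : HodgeModel (2 * n) X} {hM : M.IsHodgeSymmetric}
    {T : Type} [AddCommGroup T] [Module ℚ T] {H : HodgeStructure T 2} {P : H.Polarization}
    {j : H.Hom (bettiTwoHodgeStructureOfModel hX M hM)} (hT : IsTranscendentalPartHK hX M hM b H P j)
    (e : Module.Basis (Fin 6) ℚ T) (c : Fin 2 → ℚ) (hc0 : c 0 ≠ 0) (hc1 : c 1 < 0)
    (hgram : ∀ i k, -(P.form (e i) (e k)) = if i = k then Surfaces.hyperbolicTwoWeights c i else 0) :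
    HodgeConjectureFor (2 * n) X ∧ ∀ m : ℕ, HodgeConjectureFor ((m + 1) * (2 * n)) (X.pow (m + 1)) := by
  obtain ⟨a, ha, ι₀, hι₀, hiso₀⟩ := Surfaces.exists_u3m_embedding_hyperbolic_two c hc0 hc1
  exact hodgeConjectureFor_powers_k3HilbertType_of_gramEmbedding h hFF h42 hn hX hK hb hT e _ hgram ha ι₀ hι₀ hiso₀

end Literature.AlgebraicGeometry.Hyperkaehler

end
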